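import Summits.QuantumAdvantage.QuantumAdvantage.Theorems.CubicForrelationNearExactIsExactZeroModSixSecondLevelTwo
import Summits.QuantumAdvantage.QuantumAdvantage.Theorems.CubicForrelationNearExactIsExactTwoModSixPrep
import Summits.QuantumAdvantage.QuantumAdvantage.Theorems.CubicForrelationNearExactIsExactFourteenTypeO

/-!
# Crux `CubicForrelation.NearExactIsExact` (stmt-QuantumAdvantage-14043) — n = 14 at the SECOND boundary `15/16`, level 7:
  `W_g ∈ 128ℤ` and `Φ ≥ 15/16` force `g` to be BENT (two-sided)

Certificate seat `b2b-cforr-cert` (gen 9).  HONEST FRAMING: a theorem about cubic Boolean functions on 14 bits (finite slice `n = 14` of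
the crux; the top-level branch of the case analysis of `Φ ≥ 15/16 ⇒ Φ = 1`, the `n ≡ 2 (mod 6)` instance of the second dyadic
boundary) — NOT summit progress.

One-sidedly, a NON-bent cubic `g` on 14 bits with `W_g = 128·w` has capacity `≤ 15/16` (`tw_top`), so `Φ(f,g) = 15/16` is not excluded
by counting.  Two-sidedly it is: with `s = (−1)^f`, the budget `Σ_x (w − s)² = 2¹⁵(1 − Φ) ≤ 2¹¹` (from `fl_budget5`) is paid on the
set `P = {w even}` (cost `≥ 1` per point); `P` is the zero set of the cubic level parity `[w odd]` (`stub_walshTower`), so `P = ∅` — then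
Parseval makes every `|w| = 1`, i.e. `g` is bent (`fo_levelSeven_bent`) — or `#P ≥ 2¹¹` (Reed–Muller), the budget is spent exactly, `P`
is an 11-flat (`mw_flat_of_minweight`), `w = s` off `P` and `e := w − s = ±1` on `P`.  Three directions transversal to `P` (`ep_dirs3`)
localise the general 6- and 7-flat sums (`fs_flat_sum_dvd`, `sl_sum_sZ_flat`, `ep_loc3`) to `(H3)/(H4)` along `P`, the engine `fl1_flat_l1`
gives `Σ_y |ê·1_P^(y)| ≤ 2¹⁵`, while the pairing (`tms_pairing`) needs `2¹⁷`.  Hence (`fo_levelSeven`) `W_g ∈ 128ℤ ∧ Φ ≥ 15/16 ⇒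
Φ = 1 ∨ (g bent ∧ Φ = 15/16)`; the bent value `15/16` (dual distance `2⁹`) is a separate branch.

References: J. Ax (1964) / R. J. McEliece (1972); X.-D. Hou (1998); MacWilliams–Sloane (1977) Ch. 13–15; R. O'Donnell (2014) §3.3.
Everything below is proved from Mathlib and the tree; axioms are the standard three.
-/

set_option linter.dupNamespace false -- D-0017: single-problem summit ⇒ `QuantumAdvantage.QuantumAdvantage` by design

noncomputable section

namespace Summit.QuantumAdvantage.QuantumAdvantage.Theorems.CubicForrelation.NearExactIsExact

open Finset
open Literature.Computability.QuantumComplexity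
open Literature.Computability.QuantumComplexity.BuzetChailloux (bxor zeroVec bxor_bxor_cancel_left bxor_zeroVec zeroVec_bxor bxor_comm
  bxor_self)
open Literature.Computability.QuantumComplexity.DerivativeWalsh (W)

/-- **Level 7 at `Φ ≥ 15/16` on 14 bits forces bentness.**  For cubic `f, g : 𝔽₂¹⁴ → 𝔽₂` with `W_g = 128·w` and `Φ(f,g) ≥ 15/16`,
every `W_g(x)² = 2¹⁴`.  (If some `w(x)` is even, the even set is an 11-flat carrying the whole two-sided budget, and the flat engine
contradicts the pairing; otherwise Parseval.)  Finite-slice statement; NOT summit progress. [this work] -/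
theorem fo_levelSeven_bent (f g : (Fin (7 + 7) → Bool) → Bool) (hf : IsDegLeFun 3 f) (hg : IsDegLeFun 3 g)
    (w : (Fin (7 + 7) → Bool) → ℤ) (hw : ∀ x, W (fun y => signOf (g y)) x = (2 : ℝ) ^ 7 * (w x : ℝ))
    (hΦ : (15 / 16 : ℝ) ≤ forrelation f g) : ∀ x, W (fun y => signOf (g y)) x ^ 2 = (2 : ℝ) ^ (7 + 7) := by
  classical
  by_cases hall : ∀ x, Odd (w x)
  · -- all odd: Parseval pins `w² = 1`
    have hP := fl_parseval14 g
    have hsq : ∀ x, W (fun y => signOf (g y)) x ^ 2 = (2 : ℝ) ^ 14 * ((w x : ℝ)) ^ 2 := fun x => by rw [hw x]; ring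
    rw [sum_congr rfl fun x _ => hsq x, ← mul_sum] at hP
    have hsum : ∑ x, ((w x : ℝ)) ^ 2 = (2 : ℝ) ^ 14 := by
      have h2 : (2 : ℝ) ^ 28 = 2 ^ 14 * 2 ^ 14 := by norm_num
      rw [h2] at hP
      exact mul_left_cancel₀ (by positivity) hP
    have hsumZ : (∑ x, (w x ^ 2 - 1) : ℤ) = 0 := by
      have h' : ((∑ x, (w x ^ 2 - 1) : ℤ) : ℝ) = 0 := by
        push_cast
        rw [sum_sub_distrib, hsum, sum_const, card_univ, Fintype.card_fun, Fintype.card_bool, Fintype.card_fin]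
        norm_num
      exact_mod_cast h'
    have hnn : ∀ x, (0 : ℤ) ≤ w x ^ 2 - 1 := by
      intro x
      have h0 := Int.odd_iff.1 (hall x)
      have : w x ≤ -1 ∨ 1 ≤ w x := by omega
      have := tp_sq_ge (k := 1) (by norm_num) this
      linarith
    intro x
    have hx : w x ^ 2 - 1 = 0 := (sum_eq_zero_iff_of_nonneg fun y _ => hnn y).1 hsumZ x (mem_univ x)
    have hx' : ((w x : ℝ)) ^ 2 = 1 := by exact_mod_cast (show w x ^ 2 = 1 by linarith)
    rw [hsq x, hx']; norm_num
  exfalso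
  push Not at hall
  obtain ⟨x₁, hx₁⟩ := hall
  -- `u = 4w` at the Ax level
  set u : (Fin (7 + 7) → Bool) → ℤ := fun x => 4 * w x with hudef
  have hu : ∀ x, W (fun y => signOf (g y)) x = (2 : ℝ) ^ 5 * (u x : ℝ) := by
    intro x; rw [hw x]; simp only [u]; push_cast; ring
  have hu' : ∀ x, W (fun y => signOf (g y)) x = (2 : ℝ) ^ (2 * 2 + 1) * (u x : ℝ) := fun x => (hu x).trans (by norm_num)
  -- the level parity is cubic, so is the indicator of the even set
  have hp : IsDegLeFun 3 (fun x => decide (Odd (w x))) :=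
    stub_walshTower stub_axParity (7 + 7) 7 3 g w hg hw (by intro j hj hjn; omega)
  have hq : IsDegLeFun (2 + 1) (fun x => decide (Odd (w x)) ^^ true) := tb_isDegLeFun_xor_const hp true
  -- budget `Σ (w − s)² ≤ 2¹¹`
  have hbud := fl_budget5 f g u hu
  have h16 : ∀ x, (u x - 4 * sZ (f x)) ^ 2 = 16 * (w x - sZ (f x)) ^ 2 := fun x => by simp only [u]; ring
  have hB : (∑ x, (w x - sZ (f x)) ^ 2 : ℤ) ≤ 2048 := by
    have h' : ((∑ x, (u x - 4 * sZ (f x)) ^ 2 : ℤ) : ℝ) ≤ 32768 := by rw [hbud]; nlinarith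
    have h'' : (∑ x, (u x - 4 * sZ (f x)) ^ 2 : ℤ) ≤ 32768 := by exact_mod_cast h'
    rw [sum_congr rfl fun x _ => h16 x, ← mul_sum] at h''
    linarith
  -- RM: `#P ≥ 2¹¹` for the even set `P`
  set P := univ.filter (fun x : Fin (7 + 7) → Bool => ¬ Odd (w x)) with hPdef
  have hmemP : ∀ x, x ∈ P ↔ ¬ Odd (w x) := fun x => by simp [hPdef]
  have hfilt : (univ.filter fun x : Fin (7 + 7) → Bool => (decide (Odd (w x)) ^^ true) = true) = P :=
    filter_congr fun x _ => by by_cases h : Odd (w x) <;> simp [h]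
  have hRM := bb_rmWeight_holds (7 + 7) 3 (fun x => decide (Odd (w x)) ^^ true) hq ⟨x₁, by simp [hx₁]⟩
  rw [hfilt] at hRM
  have hPge : 2048 ≤ #P := by norm_num at hRM; omega
  -- everything is tight
  have hsumP : (∑ x, (if ¬ Odd (w x) then 1 else 0 : ℤ)) = #P := by rw [sum_boole]
  have hnonneg : ∀ x, 0 ≤ (w x - sZ (f x)) ^ 2 - (if ¬ Odd (w x) then 1 else 0 : ℤ) := by
    intro x
    by_cases h : Odd (w x)
    · rw [if_neg (not_not.2 h)]; have := sq_nonneg (w x - sZ (f x)); linarith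
    · rw [if_pos h]
      have hodd' : Odd (w x - sZ (f x)) := by
        have hs : Odd (sZ (f x)) := by rcases tp_sZ_cases (f x) with e | e <;> rw [e] <;> decide
        exact Int.odd_sub.2 (iff_of_false h (by simpa [Int.not_even_iff_odd] using hs))
      have h0 := Int.odd_iff.1 hodd'
      have : w x - sZ (f x) ≤ -1 ∨ 1 ≤ w x - sZ (f x) := by omega
      have := tp_sq_ge (k := 1) (by norm_num) this
      linarith
  have hPge' : (2048 : ℤ) ≤ #P := by exact_mod_cast hPge
  have hsum0 : ∑ x, ((w x - sZ (f x)) ^ 2 - (if ¬ Odd (w x) then 1 else 0 : ℤ)) = 0 := by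
    refine le_antisymm ?_ (sum_nonneg fun x _ => hnonneg x)
    rw [sum_sub_distrib, hsumP]
    linarith
  have hzero' : ∀ x, (w x - sZ (f x)) ^ 2 - (if ¬ Odd (w x) then 1 else 0 : ℤ) = 0 :=
    fun x => (sum_eq_zero_iff_of_nonneg fun y _ => hnonneg y).1 hsum0 x (mem_univ x)
  have hoff : ∀ x, Odd (w x) → w x - sZ (f x) = 0 := by
    intro x hx
    have h := hzero' x
    rw [if_neg (not_not.2 hx), sub_zero] at h
    exact (pow_eq_zero_iff two_ne_zero).1 h
  have hon : ∀ x, ¬ Odd (w x) → w x - sZ (f x) = 1 ∨ w x - sZ (f x) = -1 := by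
    intro x hx
    have h := hzero' x
    rw [if_pos hx] at h
    have h1 : (w x - sZ (f x)) * (w x - sZ (f x)) = 1 := by rw [← pow_two]; linarith
    exact mul_self_eq_one_iff.1 h1
  have hPcard : #P = 2048 := by
    have hle : (#P : ℤ) ≤ 2048 := by
      rw [← hsumP]
      exact le_trans (sum_le_sum fun x _ => by have := hnonneg x; linarith) hB
    have hle' : #P ≤ 2048 := by exact_mod_cast hle
    exact le_antisymm hle' hPge
  have hΦeq : forrelation f g = 15 / 16 := by
    have hT : (∑ x, (u x - 4 * sZ (f x)) ^ 2 : ℤ) = 32768 := by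
      have e16 : ∀ x, (u x - 4 * sZ (f x)) ^ 2 = 16 * ((w x - sZ (f x)) ^ 2 - (if ¬ Odd (w x) then 1 else 0 : ℤ)) +
          16 * (if ¬ Odd (w x) then 1 else 0 : ℤ) := fun x => by rw [h16 x]; ring
      rw [sum_congr rfl fun x _ => e16 x, sum_add_distrib, ← mul_sum, ← mul_sum, hsum0, hsumP, hPcard]
      norm_num
    have h : ((∑ x, (u x - 4 * sZ (f x)) ^ 2 : ℤ) : ℝ) = 32768 := by exact_mod_cast hT
    rw [hbud] at h
    linarith
  -- `P` is an 11-flat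
  have hmw := mw_flat_of_minweight 2 (fun x => decide (Odd (w x)) ^^ true) hq (by rw [hfilt, hPcard]; norm_num)
  rw [hfilt] at hmw
  obtain ⟨h0, hadd, hcardV, hcoset⟩ := hmw
  set V₀ := univ.filter (fun a : Fin (7 + 7) → Bool => ∀ x,
    (decide (Odd (w (bxor x a))) ^^ true) = (decide (Odd (w x)) ^^ true)) with hV₀
  have hS : P = V₀.image (bxor x₁) := hcoset x₁ (by simp [hx₁])
  rw [hPcard] at hcardV
  have hNcard : #(univ : Finset (Fin (7 + 7) → Bool)) = 16384 := by
    rw [card_univ, Fintype.card_fun, Fintype.card_bool, Fintype.card_fin]; norm_num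
  -- three transversal directions
  obtain ⟨t₁, -, t₂, -, t₃, -, n1, n2, n21, n3, n31, n32, n321⟩ := ep_dirs3 univ V₀ (by rw [hcardV, hNcard]; norm_num)
  -- the sign pattern and the vanishing of the residual off `P`
  set e : (Fin (7 + 7) → Bool) → ℤ := fun x => w x - sZ (f x) with hedef
  have he : ∀ x ∈ P, e x = 1 ∨ e x = -1 := fun x hx => hon x ((hmemP x).1 hx)
  have hF0 : ∀ y, y ∉ P → u y - 4 * sZ (f y) = 0 := by
    intro y hy
    have := hoff y (not_not.1 fun h => hy ((hmemP y).2 h))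
    simp only [u]; linarith
  have hFe : ∀ y, u y - 4 * sZ (f y) = 4 * e y := fun y => by simp only [u, e]; ring
  have hPV : ∀ x, x ∈ P → ∀ a ∈ V₀, bxor x a ∈ P := fun x hx a ha => fl1_coset_vadd hadd hS hx ha
  have hz : ∀ p ∈ P, ∀ v, v ∉ V₀ → u (bxor p v) - 4 * sZ (f (bxor p v)) = 0 :=
    fun p hp v hv => hF0 _ (fl1_coset_out h0 hadd hS hp hv)
  -- localisation by the three directions
  have hloc : ∀ {kk : ℕ} (x : Fin (7 + 7) → Bool) (a : Fin kk → Fin (7 + 7) → Bool),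
      (∀ ε : Fin kk → Bool, (fun j => x j ^^ decide (Odd #(univ.filter fun i => ε i && a i j))) ∈ P) →
      ∑ ε : Fin (kk + 3) → Bool, (u (fun j => x j ^^ decide (Odd #(univ.filter fun i =>
          ε i && (Matrix.vecCons t₁ (Matrix.vecCons t₂ (Matrix.vecCons t₃ a)) :
            Fin (kk + 3) → Fin (7 + 7) → Bool) i j))) -
        4 * sZ (f (fun j => x j ^^ decide (Odd #(univ.filter fun i =>
          ε i && (Matrix.vecCons t₁ (Matrix.vecCons t₂ (Matrix.vecCons t₃ a)) :
            Fin (kk + 3) → Fin (7 + 7) → Bool) i j))))) =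
      ∑ ε : Fin kk → Bool, 4 * e (fun j => x j ^^ decide (Odd #(univ.filter fun i => ε i && a i j))) := by
    intro kk x a hin
    have key := ep_loc3 (fun y => u y - 4 * sZ (f y)) x t₁ t₂ t₃ a
      (fun ε => hz _ (hin ε) t₁ n1) (fun ε => hz _ (hin ε) t₂ n2)
      (fun ε => by rw [iw_bxor_assoc]; exact hz _ (hin ε) _ n21)
      (fun ε => hz _ (hin ε) t₃ n3)
      (fun ε => by rw [iw_bxor_assoc]; exact hz _ (hin ε) _ n31)
      (fun ε => by rw [iw_bxor_assoc]; exact hz _ (hin ε) _ n32)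
      (fun ε => by rw [iw_bxor_assoc, iw_bxor_assoc]; exact hz _ (hin ε) _ n321)
    beta_reduce at key
    rw [key]
    exact sum_congr rfl fun ε _ => hFe _
  -- (H3) and (H4)
  have H3 : ∀ x ∈ P, ∀ a b c : Fin (7 + 7) → Bool, a ∈ V₀ → b ∈ V₀ → c ∈ V₀ →
      (4 : ℤ) ∣ ∑ ε : Fin 3 → Bool, e (fun j => x j ^^ decide (Odd #(univ.filter fun i =>
        ε i && (![a, b, c] : Fin 3 → Fin (7 + 7) → Bool) i j))) := by
    intro x hx a b c ha hb hc
    have hin : ∀ ε : Fin 3 → Bool, (fun j => x j ^^ decide (Odd #(univ.filter fun i =>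
        ε i && (![a, b, c] : Fin 3 → Fin (7 + 7) → Bool) i j))) ∈ P :=
      fun ε => fr_mem_flatPt3 V₀ h0 (· ∈ P) hPV hx ![a, b, c] (fun i => by fin_cases i <;> assumption) ε
    have h16f := fs_flat_sum_dvd (e := 4) g u hg hu x ![t₁, t₂, t₃, a, b, c] (by norm_num)
    obtain ⟨zf, hzf⟩ := sl_sum_sZ_flat f hf x ![t₁, t₂, t₃, a, b, c]
    have hzf' : ∑ ε : Fin 6 → Bool, 4 * sZ (f (fun j => x j ^^ decide (Odd #(univ.filter fun i =>
          ε i && (![t₁, t₂, t₃, a, b, c] : Fin 6 → Fin (7 + 7) → Bool) i j)))) = 16 * zf := by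
      rw [← mul_sum, hzf]; norm_num; ring
    have h16n : (16 : ℤ) ∣ ∑ ε : Fin 6 → Bool, u (fun j => x j ^^ decide (Odd #(univ.filter fun i =>
          ε i && (![t₁, t₂, t₃, a, b, c] : Fin 6 → Fin (7 + 7) → Bool) i j))) := by
      have e16 : (2 : ℤ) ^ 4 = 16 := by norm_num
      rw [e16] at h16f; exact h16f
    have h16' : (16 : ℤ) ∣ ∑ ε : Fin 6 → Bool, (u (fun j => x j ^^ decide (Odd #(univ.filter fun i =>
          ε i && (![t₁, t₂, t₃, a, b, c] : Fin 6 → Fin (7 + 7) → Bool) i j))) -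
        4 * sZ (f (fun j => x j ^^ decide (Odd #(univ.filter fun i =>
          ε i && (![t₁, t₂, t₃, a, b, c] : Fin 6 → Fin (7 + 7) → Bool) i j))))) := by
      rw [sum_sub_distrib, hzf']
      exact dvd_sub h16n (Dvd.intro _ rfl)
    rw [hloc x ![a, b, c] hin, ← mul_sum] at h16'
    obtain ⟨k16, hk16⟩ := h16'
    exact ⟨k16, by linarith⟩
  have H4 : ∀ x ∈ P, ∀ a₀ a₁ a₂ a₃ : Fin (7 + 7) → Bool, a₀ ∈ V₀ → a₁ ∈ V₀ → a₂ ∈ V₀ → a₃ ∈ V₀ →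
      (8 : ℤ) ∣ ∑ ε : Fin 4 → Bool, e (fun j => x j ^^ decide (Odd #(univ.filter fun i =>
        ε i && (![a₀, a₁, a₂, a₃] : Fin 4 → Fin (7 + 7) → Bool) i j))) := by
    intro x hx a₀ a₁ a₂ a₃ ha₀ ha₁ ha₂ ha₃
    have hin : ∀ ε : Fin 4 → Bool, (fun j => x j ^^ decide (Odd #(univ.filter fun i =>
        ε i && (![a₀, a₁, a₂, a₃] : Fin 4 → Fin (7 + 7) → Bool) i j))) ∈ P :=
      fun ε => fr_mem_flatPt4 V₀ h0 (· ∈ P) hPV hx ![a₀, a₁, a₂, a₃] (fun i => by fin_cases i <;> assumption) ε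
    have h32 := fs_flat_sum_dvd (e := 5) g u hg hu x ![t₁, t₂, t₃, a₀, a₁, a₂, a₃] (by norm_num)
    obtain ⟨zf, hzf⟩ := sl_sum_sZ_flat f hf x ![t₁, t₂, t₃, a₀, a₁, a₂, a₃]
    have hzf' : ∑ ε : Fin 7 → Bool, 4 * sZ (f (fun j => x j ^^ decide (Odd #(univ.filter fun i =>
          ε i && (![t₁, t₂, t₃, a₀, a₁, a₂, a₃] : Fin 7 → Fin (7 + 7) → Bool) i j)))) = 32 * zf := by
      rw [← mul_sum, hzf]; norm_num; ring
    have h32n : (32 : ℤ) ∣ ∑ ε : Fin 7 → Bool, u (fun j => x j ^^ decide (Odd #(univ.filter fun i =>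
          ε i && (![t₁, t₂, t₃, a₀, a₁, a₂, a₃] : Fin 7 → Fin (7 + 7) → Bool) i j))) := by
      have e32 : (2 : ℤ) ^ 5 = 32 := by norm_num
      rw [e32] at h32; exact h32
    have h32' : (32 : ℤ) ∣ ∑ ε : Fin 7 → Bool, (u (fun j => x j ^^ decide (Odd #(univ.filter fun i =>
          ε i && (![t₁, t₂, t₃, a₀, a₁, a₂, a₃] : Fin 7 → Fin (7 + 7) → Bool) i j))) -
        4 * sZ (f (fun j => x j ^^ decide (Odd #(univ.filter fun i =>
          ε i && (![t₁, t₂, t₃, a₀, a₁, a₂, a₃] : Fin 7 → Fin (7 + 7) → Bool) i j))))) := by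
      rw [sum_sub_distrib, hzf']
      exact dvd_sub h32n (Dvd.intro _ rfl)
    rw [hloc x ![a₀, a₁, a₂, a₃] hin, ← mul_sum] at h32'
    obtain ⟨k32, hk32⟩ := h32'
    exact ⟨k32, by linarith⟩
  -- the engine and the pairing
  have hE := fl1_flat_l1 V₀ P x₁ h0 hadd hS e he H3 H4
  set A : (Fin (7 + 7) → Bool) → ℝ := fun x => if x ∈ P then (e x : ℝ) else 0 with hA
  have hAτ : (fun x => (u x : ℝ) - (2 : ℝ) ^ 2 * signOf (f x)) = fun x => 4 * A x := by
    funext x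
    have h2 : (u x : ℝ) - (2 : ℝ) ^ 2 * signOf (f x) = (((u x - 4 * sZ (f x) : ℤ)) : ℝ) := by
      push_cast; rw [tp_sZ_cast]; ring
    rw [h2]
    by_cases hx : x ∈ P
    · simp only [A, if_pos hx]; rw [hFe x]; push_cast; ring
    · simp only [A, if_neg hx]; rw [hF0 x hx]; norm_num
  have hpair := tms_pairing 2 f g u hu'
  rw [hAτ, hΦeq] at hpair
  have hpair' : ∑ y, signOf (g y) * W A y = (2 : ℝ) ^ 17 := by
    have e2 : ∀ y, signOf (g y) * W (fun x => 4 * A x) y = 4 * (signOf (g y) * W A y) := fun y => by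
      rw [fl1_W_smul]; ring
    rw [sum_congr rfl fun y _ => e2 y, ← mul_sum] at hpair
    norm_num at hpair ⊢
    linarith
  have hge : (2 : ℝ) ^ 17 ≤ ∑ y, |W A y| := by rw [← hpair']; exact fl1_pairing_le_l1 g (W A)
  have hsq : ((2 : ℝ) ^ 17) ^ 2 ≤ (∑ y, |W A y|) ^ 2 := pow_le_pow_left₀ (by positivity) hge 2
  have hEn : (∑ y, |W A y|) ^ 2 ≤ (2 : ℝ) ^ 30 := hE.trans (by norm_num)
  have hbig : (2 : ℝ) ^ 30 < ((2 : ℝ) ^ 17) ^ 2 := by norm_num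
  linarith

/-- **Level 7 at `Φ ≥ 15/16` on 14 bits: exact, or bent at exactly `15/16`.**  For cubic `f, g : 𝔽₂¹⁴ → 𝔽₂` with `W_g ∈ 128ℤ` and
`Φ(f,g) ≥ 15/16`: `Φ(f,g) = 1`, or `g` is bent and `Φ(f,g) = 15/16` (dual distance `2⁹`; Hou + Reed–Muller give `Φ ≤ 15/16` for a bent
`g` unless exact).  The bent value `15/16` is NOT excluded here.  Finite-slice statement; NOT summit progress. [this work] -/
theorem fo_levelSeven (f g : (Fin (7 + 7) → Bool) → Bool) (hf : IsDegLeFun 3 f) (hg : IsDegLeFun 3 g)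
    (w : (Fin (7 + 7) → Bool) → ℤ) (hw : ∀ x, W (fun y => signOf (g y)) x = (2 : ℝ) ^ 7 * (w x : ℝ))
    (hΦ : (15 / 16 : ℝ) ≤ forrelation f g) :
    forrelation f g = 1 ∨
      ((∀ x, W (fun y => signOf (g y)) x ^ 2 = (2 : ℝ) ^ (7 + 7)) ∧ forrelation f g = 15 / 16) := by
  have hbent := fo_levelSeven_bent f g hf hg w hw hΦ
  rcases tw_bent_end (by norm_num : 3 ≤ 7) f g hf hg hbent with h | h
  · exact Or.inl h
  · right
    refine ⟨hbent, le_antisymm ?_ hΦ⟩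
    norm_num at h
    exact h

end Summit.QuantumAdvantage.QuantumAdvantage.Theorems.CubicForrelation.NearExactIsExact

end
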